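import Literature.Algebra.EuclideanLattices.GaussianLatticeSums
import Literature.Algebra.EuclideanLattices.DualLatticeProofs
import Literature.Algebra.EuclideanLattices.IntegerLatticeTheta
import HarnessLib

/-!
# Bost's theta invariants `h⁰_θ`, `h¹_θ` of a Euclidean lattice, the Arakelov degree, and the
# Poisson–Riemann–Roch formula `h⁰_θ(Ē) − h¹_θ(Ē) = deg^ Ē`

Topic `Literature/Algebra/EuclideanLattices`. Three definitions (with bodies) and their printed
basic properties, all PROVED from the tree's Poisson identity for Gaussians over a full lattice
(`tsum_gaussianFunction_eq`, Banaszczyk 1993 Lemma 1.1, `GaussianLatticeSums.lean`) and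
`covol(L*) = covol(L)⁻¹` (`covolume_dualLattice_holds`, `DualLatticeProofs.lean`); no named fact.

A Euclidean lattice `Ē = (E, ‖·‖)` (a hermitian vector bundle over `Spec ℤ`) is here a full-rank
discrete `ℤ`-submodule `L` of a finite-dimensional real inner product space `V`
(`[DiscreteTopology L] [IsZLattice ℝ L]`), its dual `Ē^∨` is the tree's `dualLattice L ⊆ V` (same
inner product), and `e^{-π‖v‖²}` is the tree's `gaussianFunction 1 v`.

* `hZeroTheta L` — **`h⁰_θ(Ē) := log Σ_{v ∈ E} e^{−π‖v‖²}`** [Bost2015, §3.2.1 eq. (defhot)]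
  (van der Geer–Schoof's `h⁰` of an Arakelov divisor, for `K = ℚ`);
* `hOneTheta L` — **`h¹_θ(Ē) := h⁰_θ(Ē^∨)`** [Bost2015, §3.2.1 eq. (defhut)];
* `arakelovDegree L` — **`deg^ Ē := −log covol(Ē)`** (the Arakelov degree of a Euclidean lattice,
  [Bost2015, §2.1]);
* `tsum_gaussianFunction_dualLattice_eq` — the Poisson formula as printed in [Bost2015, §3.2.1]:
  `Σ_{w ∈ E^∨} e^{−π‖w‖²} = covol(Ē) · Σ_{v ∈ E} e^{−π‖v‖²}`;
* `hZeroTheta_sub_hOneTheta` — **Poisson–Riemann–Roch** [Bost2015, §3.2.1 eq. (PoissonZ)]: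
  `h⁰_θ(Ē) − h¹_θ(Ē) = deg^ Ē`;
* `hZeroTheta_nonneg`, `hZeroTheta_pos`, `hOneTheta_nonneg`, `hOneTheta_pos` — [Bost2015,
  Prop. 3.3.1]: `h⁰_θ(Ē), h¹_θ(Ē) ≥ 0`, and `> 0` when `rk E > 0`;
* `arakelovDegree_le_hZeroTheta` — the "Riemann inequality" `h⁰_θ(Ē) ≥ deg^ Ē` [Bost2015,
  eq. after Prop. 3.3.1];
* `hOneTheta_dualLattice`, `arakelovDegree_dualLattice` — `h¹_θ(Ē^∨) = h⁰_θ(Ē)`,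
  `deg^ Ē^∨ = −deg^ Ē` (biduality `E^∨∨ = E`, `covol(E^∨) = covol(E)⁻¹`);
* `two_mul_inv_covolume_sub_le_tsum` — [Bost2015, §3.1, second display]: for `x ∈ V`,
  `Σ_{v ∈ E} e^{−π‖x − v‖²} ≥ 2 covol(Ē)⁻¹ − Σ_{v ∈ E} e^{−π‖v‖²}` (the first display,
  `Σ_v e^{−π‖x−v‖²} ≤ Σ_v e^{−π‖v‖²}`, is the tree's `tsum_gaussianFunction_sub_le` at `s = 1`,
  restated as `tsum_gaussianFunction_sub_le_one`).

Context (why this file exists): these are the exact finite-level identities of the "theta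
invariant / Euclidean lattice" constructions around the Riemann zeta function (van der Geer–Schoof
2000, Bost 2020): their printed content is Poisson duality and positivity, not a trace formula.

## References

* J.-B. Bost, *Theta invariants of Euclidean lattices and infinite-dimensional Hermitian vector
  bundles over arithmetic curves*, arXiv:1512.08946, §2.1, §3.1, §3.2.1 (defhot, defhut, PoissonZ),
  Prop. 3.3.1 [Bost2015]; Progress in Math. 334, Birkhäuser (2020) [Bost2020].
* G. van der Geer, R. Schoof, *Effectivity of Arakelov divisors and the theta divisor of a number
  field*, Selecta Math. 6 (2000), arXiv:math/9802121, §1 (`h⁰(D) = log Σ_{f ∈ I} e^{−π‖f‖²_D}`).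
* W. Banaszczyk, Math. Ann. 296 (1993), Lemma 1.1 (the Poisson identity used) [Banaszczyk1993].

## Design

`hZeroTheta` and `arakelovDegree` take a bare `Submodule ℤ V` (no lattice instances in the
definitions; the theorems assume `[DiscreteTopology L] [IsZLattice ℝ L]`), so that rewriting along
`dualLattice (dualLattice L) = L` is painless. The covolume is Mathlib's `ZLattice.covolume L` for
the canonical Lebesgue measure `volume` of the inner product space (the only measure for which
`covol(L*) = covol(L)⁻¹` holds, see `DualLattice.lean`). Number fields other than `ℚ` (direct images
`π_* Ē`, the `−½ log|Δ_K| · rk` term of [Bost2015, eq. (Poisson)]) are NOT treated here.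
-/

noncomputable section

open MeasureTheory Module Real
open scoped InnerProductSpace

namespace Literature.Algebra.EuclideanLattices

variable {V : Type*} [NormedAddCommGroup V] [InnerProductSpace ℝ V] [FiniteDimensional ℝ V]
  [MeasurableSpace V] [BorelSpace V]

/-! ## Definitions -/

/-- **Bost's theta invariant `h⁰_θ(Ē) := log Σ_{v ∈ E} e^{−π‖v‖²}`** of a Euclidean lattice
`Ē = (L, ‖·‖)` (van der Geer–Schoof's `h⁰`; here `e^{−π‖v‖²} = gaussianFunction 1 v`). Defined for
any `ℤ`-submodule; meaningful (the series converges) for a discrete one.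
[cite: Bost2015, §3.2.1 eq. (defhot)] -/
def hZeroTheta (L : Submodule ℤ V) : ℝ :=
  Real.log (∑' v : L, gaussianFunction 1 (v : V))

/-- **`h¹_θ(Ē) := h⁰_θ(Ē^∨)`**, the theta invariant of the dual Euclidean lattice
(`dualLattice L`, same inner product). [cite: Bost2015, §3.2.1 eq. (defhut)] -/
def hOneTheta (L : Submodule ℤ V) : ℝ :=
  hZeroTheta (dualLattice L)

/-- **The Arakelov degree `deg^ Ē := −log covol(Ē)`** of a Euclidean lattice (for the canonical
Lebesgue measure of the inner product space). [cite: Bost2015, §2.1] -/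
def arakelovDegree (L : Submodule ℤ V) : ℝ :=
  -Real.log (ZLattice.covolume L)

omit [InnerProductSpace ℝ V] [FiniteDimensional ℝ V] [MeasurableSpace V] [BorelSpace V] in
/-- `gaussianFunction 1 v = e^{−π‖v‖²}`. [cite: Bost2015, §3.2.1 eq. (defhot)] -/
theorem gaussianFunction_one (v : V) : gaussianFunction 1 v = Real.exp (-π * ‖v‖ ^ 2) := by
  rw [gaussianFunction, one_pow, div_one]

variable (L : Submodule ℤ V) [DiscreteTopology L] [IsZLattice ℝ L]

omit [MeasurableSpace V] [BorelSpace V] [IsZLattice ℝ L] in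
/-- The theta series `Σ_{v ∈ E} e^{−π‖v‖²}` of a discrete lattice converges.
[cite: Bost2015, §3.2.1 eq. (defhot)] -/
theorem summable_gaussianFunction_one : Summable fun v : L => gaussianFunction 1 (v : V) := by
  simpa using summable_gaussianFunction_sub L one_ne_zero (0 : V)

omit [MeasurableSpace V] [BorelSpace V] [IsZLattice ℝ L] in
/-- `Σ_{v ∈ E} e^{−π‖v‖²} ≥ 1` (the term `v = 0`). [cite: Bost2015, Prop. 3.3.1] -/
theorem one_le_tsum_gaussianFunction_one : 1 ≤ ∑' v : L, gaussianFunction 1 (v : V) := by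
  calc (1 : ℝ) = gaussianFunction 1 ((0 : L) : V) := by
        rw [Submodule.coe_zero, gaussianFunction_zero]
    _ ≤ ∑' v : L, gaussianFunction 1 (v : V) :=
        (summable_gaussianFunction_one L).le_tsum 0 fun j _ => (gaussianFunction_pos _ _).le

omit [MeasurableSpace V] [BorelSpace V] [IsZLattice ℝ L] in
/-- `Σ_{v ∈ E} e^{−π‖v‖²} > 0`. [cite: Bost2015, Prop. 3.3.1] -/
theorem tsum_gaussianFunction_one_pos : 0 < ∑' v : L, gaussianFunction 1 (v : V) :=
  one_pos.trans_le (one_le_tsum_gaussianFunction_one L)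

omit [MeasurableSpace V] [BorelSpace V] [IsZLattice ℝ L] in
/-- `exp h⁰_θ(Ē) = Σ_{v ∈ E} e^{−π‖v‖²}`. [cite: Bost2015, §3.2.1 eq. (defhot)] -/
theorem exp_hZeroTheta : Real.exp (hZeroTheta L) = ∑' v : L, gaussianFunction 1 (v : V) := by
  rw [hZeroTheta, Real.exp_log (tsum_gaussianFunction_one_pos L)]

omit [FiniteDimensional ℝ V] [MeasurableSpace V] [BorelSpace V] in
/-- A full lattice in a nonzero space has a nonzero vector. [cite: Bost2015, Prop. 3.3.1] -/
theorem exists_mem_ne_zero [Nontrivial V] : ∃ v ∈ L, v ≠ 0 := by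
  refine Submodule.exists_mem_ne_zero_of_ne_bot fun h => ?_
  have hspan : Submodule.span ℝ (L : Set V) = ⊤ := IsZLattice.span_top
  rw [h, Submodule.bot_coe, Submodule.span_zero_singleton] at hspan
  exact bot_ne_top hspan

omit [MeasurableSpace V] [BorelSpace V] in
/-- `Σ_{v ∈ E} e^{−π‖v‖²} > 1` when `rk E > 0` (the terms `v = 0` and `v = v₀ ≠ 0`).
[cite: Bost2015, Prop. 3.3.1] -/
theorem one_lt_tsum_gaussianFunction_one [Nontrivial V] :
    1 < ∑' v : L, gaussianFunction 1 (v : V) := by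
  classical
  obtain ⟨v, hv, hv0⟩ := exists_mem_ne_zero L
  have hne : (0 : L) ≠ ⟨v, hv⟩ := fun h => hv0 (by simpa using (congrArg Subtype.val h).symm)
  calc (1 : ℝ) < gaussianFunction 1 ((0 : L) : V) + gaussianFunction 1 ((⟨v, hv⟩ : L) : V) := by
        rw [Submodule.coe_zero, gaussianFunction_zero]
        linarith [gaussianFunction_pos 1 v]
    _ = ∑ x ∈ ({(0 : L), ⟨v, hv⟩} : Finset L), gaussianFunction 1 (x : V) :=
        (Finset.sum_pair (f := fun y : L => gaussianFunction 1 (y : V)) hne).symm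
    _ ≤ ∑' x : L, gaussianFunction 1 (x : V) :=
        (summable_gaussianFunction_one L).sum_le_tsum _ fun j _ => (gaussianFunction_pos _ _).le

/-! ## The Poisson formula and the Poisson–Riemann–Roch formula -/

/-- **The Poisson formula for a Euclidean lattice**, as printed in [Bost2015, §3.2.1]:
`Σ_{w ∈ E^∨} e^{−π‖w‖²} = covol(Ē) · Σ_{v ∈ E} e^{−π‖v‖²}` (the tree's Banaszczyk identity
`ρ_s(L) = covol(L)⁻¹ sⁿ ρ_{1/s}(L*)` at `s = 1`). [cite: Bost2015, §3.2.1 eq. (PoissonZ)] -/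
theorem tsum_gaussianFunction_dualLattice_eq :
    ∑' w : dualLattice L, gaussianFunction 1 (w : V) =
      ZLattice.covolume L * ∑' v : L, gaussianFunction 1 (v : V) := by
  have h := tsum_gaussianFunction_eq L one_pos
  rw [one_pow, mul_one, inv_one] at h
  rw [h, ← mul_assoc, mul_inv_cancel₀ (ZLattice.covolume_pos L volume).ne', one_mul]

/-- **Poisson–Riemann–Roch formula** for a Euclidean lattice: `h⁰_θ(Ē) − h¹_θ(Ē) = deg^ Ē`
("observe the similarity with the Serre duality and the Riemann–Roch formula for vector bundles over
an elliptic curve"). [cite: Bost2015, §3.2.1 eq. (PoissonZ)] -/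
theorem hZeroTheta_sub_hOneTheta : hZeroTheta L - hOneTheta L = arakelovDegree L := by
  rw [hOneTheta, hZeroTheta, hZeroTheta, arakelovDegree, tsum_gaussianFunction_dualLattice_eq L,
    Real.log_mul (ZLattice.covolume_pos L volume).ne' (tsum_gaussianFunction_one_pos L).ne']
  ring

/-- Equivalent form `h¹_θ(Ē) = h⁰_θ(Ē) − deg^ Ē = log (covol(Ē) · Σ_{v ∈ E} e^{−π‖v‖²})`.
[cite: Bost2015, §3.2.2] -/
theorem hOneTheta_eq_log :
    hOneTheta L = Real.log (ZLattice.covolume L * ∑' v : L, gaussianFunction 1 (v : V)) := by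
  rw [hOneTheta, hZeroTheta, tsum_gaussianFunction_dualLattice_eq L]

/-! ## Positivity (Bost, Prop. 3.3.1) and the Riemann inequality -/

omit [MeasurableSpace V] [BorelSpace V] [IsZLattice ℝ L] in
/-- **`h⁰_θ(Ē) ≥ 0`.** [cite: Bost2015, Prop. 3.3.1] -/
theorem hZeroTheta_nonneg : 0 ≤ hZeroTheta L :=
  Real.log_nonneg (one_le_tsum_gaussianFunction_one L)

omit [MeasurableSpace V] [BorelSpace V] in
/-- **`h⁰_θ(Ē) > 0` if `Ē` has positive rank.** [cite: Bost2015, Prop. 3.3.1] -/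
theorem hZeroTheta_pos [Nontrivial V] : 0 < hZeroTheta L :=
  Real.log_pos (one_lt_tsum_gaussianFunction_one L)

omit [MeasurableSpace V] [BorelSpace V] in
/-- **`h¹_θ(Ē) ≥ 0`.** [cite: Bost2015, Prop. 3.3.1] -/
theorem hOneTheta_nonneg : 0 ≤ hOneTheta L :=
  hZeroTheta_nonneg (dualLattice L)

omit [MeasurableSpace V] [BorelSpace V] in
/-- **`h¹_θ(Ē) > 0` if `Ē` has positive rank.** [cite: Bost2015, Prop. 3.3.1] -/
theorem hOneTheta_pos [Nontrivial V] : 0 < hOneTheta L :=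
  hZeroTheta_pos (dualLattice L)

/-- **The Riemann inequality `h⁰_θ(Ē) ≥ deg^ Ē`** (Poisson–Riemann–Roch plus `h¹_θ ≥ 0`).
[cite: Bost2015, Prop. 3.3.1 (eq. following)] -/
theorem arakelovDegree_le_hZeroTheta : arakelovDegree L ≤ hZeroTheta L := by
  have h := hZeroTheta_sub_hOneTheta L
  have h' := hOneTheta_nonneg L
  linarith

/-- Likewise `h¹_θ(Ē) ≥ −deg^ Ē`. [cite: Bost2015, Prop. 3.3.1 (eq. following)] -/
theorem neg_arakelovDegree_le_hOneTheta : -arakelovDegree L ≤ hOneTheta L := by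
  have h := hZeroTheta_sub_hOneTheta L
  have h' := hZeroTheta_nonneg L
  linarith

/-! ## Duality -/

omit [MeasurableSpace V] [BorelSpace V] in
/-- **`h¹_θ(Ē^∨) = h⁰_θ(Ē)`** (biduality `E^∨∨ = E`). [cite: Bost2015, §3.2.1 eq. (defhut)] -/
theorem hOneTheta_dualLattice : hOneTheta (dualLattice L) = hZeroTheta L := by
  rw [hOneTheta, dualLattice_dualLattice]

/-- **`deg^ Ē^∨ = −deg^ Ē`** (`covol(E^∨) = covol(E)⁻¹`). [cite: Bost2015, §2.1] -/
theorem arakelovDegree_dualLattice : arakelovDegree (dualLattice L) = -arakelovDegree L := by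
  have h : ZLattice.covolume (dualLattice L) = (ZLattice.covolume L)⁻¹ := covolume_dualLattice_holds L
  rw [arakelovDegree, arakelovDegree, h, Real.log_inv, neg_neg]

/-- Poisson–Riemann–Roch for the dual: `h⁰_θ(Ē^∨) − h⁰_θ(Ē) = −deg^ Ē`, i.e.
`h¹_θ(Ē) − h⁰_θ(Ē) = deg^ Ē^∨`. [cite: Bost2015, §3.2.1 eq. (PoissonZ)] -/
theorem hOneTheta_sub_hZeroTheta : hOneTheta L - hZeroTheta L = arakelovDegree (dualLattice L) := by
  rw [arakelovDegree_dualLattice, ← hZeroTheta_sub_hOneTheta L]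
  ring

/-! ## Self-dual (unimodular) Euclidean lattices -/

/-- For a self-dual Euclidean lattice (`E^∨ = E`, e.g. `ℤⁿ`, `E₈`, the Niemeier lattices) the
Arakelov degree vanishes: `deg^ Ē = −log covol(Ē) = 0` (the tree's
`covolume_eq_one_of_dualLattice_eq`: a self-dual lattice has covolume `1`).
[cite: Bost2015, §2.1] -/
theorem arakelovDegree_eq_zero_of_dualLattice_eq (h : dualLattice L = L) : arakelovDegree L = 0 := by
  rw [arakelovDegree, covolume_eq_one_of_dualLattice_eq L h, Real.log_one, neg_zero]

omit [FiniteDimensional ℝ V] [MeasurableSpace V] [BorelSpace V] [DiscreteTopology L]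
  [IsZLattice ℝ L] in
/-- For a self-dual Euclidean lattice `h¹_θ(Ē) = h⁰_θ(Ē)` — the Poisson–Riemann–Roch formula with
`deg^ Ē = 0`, or directly from the definition `h¹_θ(Ē) = h⁰_θ(Ē^∨)`.
[cite: Bost2015, §3.2.1 eq. (defhut)] -/
theorem hOneTheta_eq_of_dualLattice_eq (h : dualLattice L = L) : hOneTheta L = hZeroTheta L := by
  rw [hOneTheta, h]

/-! ## Bost §3.1: the Gaussian sums of the translates `x + E` -/

/-- [Bost2015, §3.1, first display]: for every `x ∈ V`,
`Σ_{v ∈ E} e^{−π‖x − v‖²} ≤ Σ_{v ∈ E} e^{−π‖v‖²}` (the tree's Banaszczyk inequality at `s = 1`).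
[cite: Bost2015, §3.1 eq. (PoissonGaussineq)] -/
theorem tsum_gaussianFunction_sub_le_one (x : V) :
    ∑' v : L, gaussianFunction 1 ((v : V) - x) ≤ ∑' v : L, gaussianFunction 1 (v : V) :=
  tsum_gaussianFunction_sub_le L one_pos x

/-- [Bost2015, §3.1, second display]: for every `x ∈ V`,
`Σ_{v ∈ E} e^{−π‖x − v‖²} ≥ 2 covol(Ē)⁻¹ − Σ_{v ∈ E} e^{−π‖v‖²}`. Proof: by the shifted Poisson
identity the left side is `covol⁻¹ Σ_{w ∈ E^∨} e^{−π‖w‖²} cos(2π⟨x,w⟩)`, and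
`Σ_w e^{−π‖w‖²} (1 + cos(2π⟨x,w⟩)) ≥ 2` (the term `w = 0`), while
`covol⁻¹ Σ_w e^{−π‖w‖²} = Σ_v e^{−π‖v‖²}`. [cite: Bost2015, §3.1 (display following eq. (PoissonGaussineq))] -/
theorem two_mul_inv_covolume_sub_le_tsum (x : V) :
    2 * (ZLattice.covolume L)⁻¹ - ∑' v : L, gaussianFunction 1 (v : V) ≤
      ∑' v : L, gaussianFunction 1 ((v : V) - x) := by
  have hshift := tsum_gaussianFunction_sub_eq L one_pos x
  have hzero := tsum_gaussianFunction_eq L one_pos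
  rw [one_pow, mul_one, inv_one] at hshift hzero
  rw [hshift, hzero]
  set c : ℝ := (ZLattice.covolume L)⁻¹ with hc_def
  have hc : 0 ≤ c := inv_nonneg.2 (ZLattice.covolume_pos L volume).le
  have hS : Summable fun w : dualLattice L => gaussianFunction 1 (w : V) :=
    summable_gaussianFunction_one (dualLattice L)
  have hSc : Summable fun w : dualLattice L =>
      gaussianFunction 1 (w : V) * Real.cos (2 * π * ⟪x, (w : V)⟫_ℝ) :=
    summable_gaussianFunction_mul_cos _ one_ne_zero x
  have hsum : Summable fun w : dualLattice L =>
      gaussianFunction 1 (w : V) + gaussianFunction 1 (w : V) * Real.cos (2 * π * ⟪x, (w : V)⟫_ℝ) :=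
    hS.add hSc
  have h2 : (2 : ℝ) ≤ ∑' w : dualLattice L,
      (gaussianFunction 1 (w : V) + gaussianFunction 1 (w : V) * Real.cos (2 * π * ⟪x, (w : V)⟫_ℝ)) := by
    calc (2 : ℝ) = gaussianFunction 1 ((0 : dualLattice L) : V) +
          gaussianFunction 1 ((0 : dualLattice L) : V) *
            Real.cos (2 * π * ⟪x, ((0 : dualLattice L) : V)⟫_ℝ) := by
          rw [Submodule.coe_zero, gaussianFunction_zero, inner_zero_right, mul_zero, Real.cos_zero]
          norm_num
      _ ≤ _ := hsum.le_tsum 0 fun w _ => by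
          have h1 : -1 ≤ Real.cos (2 * π * ⟪x, (w : V)⟫_ℝ) := Real.neg_one_le_cos _
          have h0 : 0 ≤ gaussianFunction 1 (w : V) := (gaussianFunction_pos _ _).le
          nlinarith
  have hsplit : ∑' w : dualLattice L,
      (gaussianFunction 1 (w : V) + gaussianFunction 1 (w : V) * Real.cos (2 * π * ⟪x, (w : V)⟫_ℝ)) =
      (∑' w : dualLattice L, gaussianFunction 1 (w : V)) +
        ∑' w : dualLattice L, gaussianFunction 1 (w : V) * Real.cos (2 * π * ⟪x, (w : V)⟫_ℝ) :=
    hS.tsum_add hSc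
  rw [hsplit] at h2
  have key : 2 - ∑' w : dualLattice L, gaussianFunction 1 (w : V) ≤
      ∑' w : dualLattice L, gaussianFunction 1 (w : V) * Real.cos (2 * π * ⟪x, (w : V)⟫_ℝ) := by
    linarith
  have := mul_le_mul_of_nonneg_left key hc
  linarith [this]

end Literature.Algebra.EuclideanLattices

end
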